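import Mathlib
import Literature.NumberTheory.Sieve.PolymathThetaLevel
import Literature.NumberTheory.Sieve.LevelOfDistributionProofs
import Literature.NumberTheory.Sieve.ParityBarrierLevelProofs
import HarnessLib

/-!
# Maynard (2016), Lemma 7: the Bombieri–Vinogradov step — displays (6.30)–(6.31)

Trunk: AntSieve / parity (Maynard 2016 large-gaps ladder; named fact
`Literature.NumberTheory.Sieve.Maynard2016.Lemma7Tuple`).

J. Maynard, *Large gaps between primes*, Ann. of Math. 183 (2016) = arXiv:1408.5110, §6, proof of
Lemma 7, displays (6.30)–(6.31) (p. 12): the error terms `E(x; q)` of (6.29), weighted by the number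
`O(τ_{O(k)}(q))`-many ways the modulus `q` arises, "contribute `O_k(x/(log x)^{4k})` by Cauchy–Schwarz, the
trivial bound `E(x; q) ≪ x/q` and the Bombieri–Vinogradov theorem (since `q < x^{1/2−ε}`)".

PROVED here: the tree's Bombieri–Vinogradov theorem (`BombieriVinogradovStatement_holds`, in the
`π`-form `BombieriVinogradovStatement.primesHaveLevelPi`) combined with the Polymath-8b weighted form
`PrimesHaveLevelPi.isBigO_sum_pow_omega_mul_errMax` (which packages exactly the Cauchy–Schwarz /
trivial-bound argument) gives, for every `θ < 1/2`, `K ≥ 0`, `A > 0`: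
`Maynard2016.exists_eventually_sum_pow_omega_mul_errMax_le :
  ∃ C, ∀ᶠ x : ℕ, Σ_{q ≤ x^θ} K^{ω(q)} E(x; q) ≤ C x/(log x)^A`
(`E(x; q) = primeCountingAPErrMax x q = sup_{y ≤ x} sup_{(a,q)=1} |π(y; q, a) − π(y)/φ(q)|`).

## References

* J. Maynard, *Large gaps between primes*, Ann. of Math. (2) 183 (2016), 915–933; arXiv:1408.5110,
  §6, proof of Lemma 7, displays (6.30)–(6.31). [Maynard2016LargeGaps]
-/

open Finset Filter Asymptotics
open scoped BigOperators ArithmeticFunction.omega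

namespace Literature.NumberTheory.Sieve

namespace Maynard2016

/-- **Bombieri–Vinogradov with divisor-type weights, Lemma-7 form**: for `θ < 1/2`, `K ≥ 0`, `A > 0`
there is `C` with `Σ_{q ≤ x^θ} K^{ω(q)} E(x; q) ≤ C x/(log x)^A` for all large `x ∈ ℕ`.
[cite: Maynard2016LargeGaps, Lemma 7 (proof, displays (6.30)–(6.31))] -/
theorem exists_eventually_sum_pow_omega_mul_errMax_le {θ : ℝ} (hθ : θ < 1 / 2) {K : ℝ} (hK : 0 ≤ K)
    {A : ℝ} (hA : 0 < A) :
    ∃ C : ℝ, ∀ᶠ x : ℕ in atTop,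
      ∑ q ∈ Icc 1 ⌊(x : ℝ) ^ θ⌋₊, K ^ ω q * primeCountingAPErrMax x q ≤ C * x / Real.log x ^ A := by
  -- level `θ' = (θ + 1/2)/2 < 1/2` in the `π`-form, with room `ε = θ' − θ > 0`
  set θ' : ℝ := (θ + 1 / 2) / 2 with hθ'
  have hθ'lt : θ' < 1 / 2 := by rw [hθ']; linarith
  have hε : 0 < θ' - θ := by rw [hθ']; linarith
  have hlev : PrimesHaveLevelPi θ' := BombieriVinogradovStatement_holds.primesHaveLevelPi hθ'lt
  have hbig := hlev.isBigO_sum_pow_omega_mul_errMax hε hK hA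
  have hθeq : θ' - (θ' - θ) = θ := by ring
  rw [hθeq] at hbig
  obtain ⟨C, hCpos, hC⟩ := hbig.exists_pos
  rw [IsBigOWith] at hC
  refine ⟨C, ?_⟩
  have hC' := tendsto_natCast_atTop_atTop.eventually hC
  filter_upwards [hC', eventually_gt_atTop 1] with x hx hx1
  have hx1' : (1 : ℝ) < x := by exact_mod_cast hx1
  have hlog : 0 < Real.log x := Real.log_pos hx1'
  have hpos : 0 < (x : ℝ) / Real.log x ^ A := div_pos (by positivity) (Real.rpow_pos_of_pos hlog A)
  rw [Real.norm_of_nonneg (Finset.sum_nonneg fun q _ => mul_nonneg (pow_nonneg hK _)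
      (primeCountingAPErrMax_nonneg _ _)), Real.norm_of_nonneg hpos.le] at hx
  calc ∑ q ∈ Icc 1 ⌊(x : ℝ) ^ θ⌋₊, K ^ ω q * primeCountingAPErrMax x q
        ≤ C * ((x : ℝ) / Real.log x ^ A) := hx
    _ = C * x / Real.log x ^ A := by ring

/-- The same with the trivial enlargement to squarefree-restricted or sub-summed ranges: any
`S ⊆ [1, x^θ]` has `Σ_{q ∈ S} K^{ω(q)} E(x; q) ≤ C x/(log x)^A`. [cite: Maynard2016LargeGaps, Lemma 7 (proof, displays (6.30)–(6.31))] -/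
theorem exists_eventually_sum_subset_errMax_le {θ : ℝ} (hθ : θ < 1 / 2) {K : ℝ} (hK : 0 ≤ K)
    {A : ℝ} (hA : 0 < A) :
    ∃ C : ℝ, ∀ᶠ x : ℕ in atTop, ∀ S : Finset ℕ, S ⊆ Icc 1 ⌊(x : ℝ) ^ θ⌋₊ →
      ∑ q ∈ S, K ^ ω q * primeCountingAPErrMax x q ≤ C * x / Real.log x ^ A := by
  obtain ⟨C, hC⟩ := exists_eventually_sum_pow_omega_mul_errMax_le hθ hK hA
  refine ⟨C, ?_⟩
  filter_upwards [hC] with x hx S hS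
  exact le_trans (Finset.sum_le_sum_of_subset_of_nonneg hS fun q _ _ =>
    mul_nonneg (pow_nonneg hK _) (primeCountingAPErrMax_nonneg _ _)) hx

end Maynard2016

end Literature.NumberTheory.Sieve
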